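import Mathlib
import Summits.CriticalPhenomena.SAWScalingLimit.Theorems.SAWDefectDecoherenceDefectDecoherenceSsSectorRowD
import HarnessLib

/-!
# The two sources of the `D`-row are pure differences (helpers for the stubs
`stub_signalStarGradient` / `stub_unstableStarGradient` of the line `sector-slaving`,
crux `DefectDecoherence`, stmt-CriticalPhenomena-8549)

The `D`-row of the sector system (`stub_sectorRowD`) feeds the defect sector at a vertex `v` from two
SOURCES over the star of `v`: the `S`-source `signalSource = Σ_{t ∼ v} ē(t) S(t)` and the `U`-source
`unstableSource = Σ_{t ∼ v} ē(t)² U(t)` (`e(t) = dartUnit v t`, `S, U = A_{5/8}, A_{-3/8}` the clean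
arrival characters at the neighbour `t`).  At a `1`-deep `v` the three darts are `e, ζ²e, ζ⁴e`
(`ζ = e^{iπ/3}`), so

* `Σ_t e(t) = 0`, `Σ_t e(t)² = 0` and their conjugates (`ss_sum_dartUnit`, `ss_sum_dartUnit_sq`,
  `ss_sum_conj_dartUnit`, `ss_sum_conj_dartUnit_sq`);
* hence both sources are PURE DIFFERENCES: `Σ_t ē(t) S(t) = Σ_t ē(t) (S(t) - S(v))` and
  `Σ_t ē(t)² U(t) = Σ_t ē(t)² (U(t) - U(v))` (`ss_signalSource_eq_diff`, `ss_unstableSource_eq_diff`;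
  generic form `ss_sum_weight_mul_eq_diff`), and, the darts being unit vectors (`ss_norm_dartUnit`),
  `‖signalSource(v)‖ ≤ Σ_t ‖S(t) - S(v)‖`, `‖unstableSource(v)‖ ≤ Σ_t ‖U(t) - U(v)‖`
  (`ss_norm_signalSource_le`, `ss_norm_unstableSource_le`);
* consequently each of the two stubs FOLLOWS from the corresponding one-step modulus-of-continuity
  (Lipschitz) decay of its sector against the star mass (`ss_decayBound_signalSource_of_diff`,
  `ss_decayBound_unstableSource_of_diff`).

These are exact finite identities and triangle inequalities only.  They exhibit the stubs
`stub_signalStarGradient` (5) and `stub_unstableStarGradient` (4) as one-step modulus-of-continuity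
statements for the sectors `S` and `U` at relative precision `R^{-θ}`, `θ > 3/4`; they prove NOTHING
about that decay, which is the open content of the stubs (no rigorous regularity theory for the critical
self-avoiding-walk arrival law is available).

Sources: H. Duminil-Copin, S. Smirnov, Ann. of Math. 175 (2012) (arXiv:1007.0575), §2; the line card
`Cruxes/DefectDecoherence/Lines/sector-slaving.md`.
-/

noncomputable section

open scoped BigOperators ComplexConjugate Classical
open Literature.Probability.LatticeModels Literature.Probability.RandomPlanarGeometry.SAW
open Summit.CriticalPhenomena.SAWScalingLimit.Theorems.DefectDecoherence.TipMartingale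
open Summit.CriticalPhenomena.SAWScalingLimit.Theorems.SpinShift

namespace Summit.CriticalPhenomena.SAWScalingLimit.Theorems.DefectDecoherence.SectorSlaving

/-! ### The three darts at a `1`-deep vertex -/

/-- Every vertex of the honeycomb lattice has a neighbour (it has three). [folklore] -/
private theorem srcDiff_exists_adj (v : HexVertex) : ∃ s, hexGraph.Adj v s := by
  have h3 : (hexGraph.neighborSet v).ncard = 3 := card_neighborSet_hexGraph_holds v
  obtain ⟨s, hs⟩ := Set.nonempty_of_ncard_ne_zero
    (show (hexGraph.neighborSet v).ncard ≠ 0 by rw [h3]; norm_num)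
  exact ⟨s, hs⟩

/-- At a `1`-deep vertex all three neighbours lie in `Λ` (adjacent centres are at distance
`1/√3 ≤ 1`). [folklore] -/
private theorem srcDiff_nbrs_mem {Λ : Finset HexVertex} {v : HexVertex} (hdeep : Deep Λ v 1) :
    ∀ t, hexGraph.Adj v t → t ∈ Λ :=
  fun t ht => hdeep t (dist_hexCenter_le_one_of_adj ht.symm)

/-- The dart of `ρ s` (`ρ = rot3 v`) is the dart of `s` turned by `120°`:
`e(ρ s) = -e^{-iπ/3} e(s)`. [folklore] -/
private theorem srcDiff_dartUnit_rot3 (v s : HexVertex) :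
    dartUnit v (rot3 v s) =
      -(Complex.exp (((-(Real.pi / 3) : ℝ) : ℂ) * Complex.I) * dartUnit v s) := by
  rw [rowD_dartUnit_rot3 s v, rowD_dartUnit_swap v s]
  ring

/-- The dart of `ρ² s` is the dart of `s` turned by `240°`: `e(ρ² s) = -e^{iπ/3} e(s)`. [folklore] -/
private theorem srcDiff_dartUnit_rot3_rot3 (v s : HexVertex) :
    dartUnit v (rot3 v (rot3 v s)) =
      -(Complex.exp (((Real.pi / 3 : ℝ) : ℂ) * Complex.I) * dartUnit v s) := by
  rw [rowD_dartUnit_rot3_rot3 s v, rowD_dartUnit_swap v s]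
  ring

/-- `1 - e^{-iπ/3} - e^{iπ/3} = 1 - 2cos(π/3) = 0`. [folklore] -/
private theorem srcDiff_one_sub_exp_sub_exp :
    (1 : ℂ) - Complex.exp (((-(Real.pi / 3) : ℝ) : ℂ) * Complex.I) -
      Complex.exp (((Real.pi / 3 : ℝ) : ℂ) * Complex.I) = 0 := by
  rw [rowD_exp_neg_pi_div_three, rowD_exp_pi_div_three]
  push_cast
  ring

/-- `1 + e^{-2iπ/3} + e^{2iπ/3} = 1 + 2cos(2π/3) = 0`. [folklore] -/
private theorem srcDiff_one_add_exp_sq_add_exp_sq :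
    (1 : ℂ) + Complex.exp (((-(Real.pi / 3) : ℝ) : ℂ) * Complex.I) ^ 2 +
      Complex.exp (((Real.pi / 3 : ℝ) : ℂ) * Complex.I) ^ 2 = 0 := by
  rw [rowD_exp_neg_pi_div_three, rowD_exp_pi_div_three]
  have h3 : ((Real.sqrt 3 : ℝ) : ℂ) * ((Real.sqrt 3 : ℝ) : ℂ) = 3 := by
    rw [← Complex.ofReal_mul, Real.mul_self_sqrt (by norm_num : (0 : ℝ) ≤ 3)]; norm_num
  set r := Real.sqrt 3 with hr
  push_cast
  linear_combination (Complex.I ^ 2 / 2) * h3 + (3 / 2 : ℂ) * Complex.I_mul_I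

/-- **Dart unit vectors are unimodular**: `‖e(t)‖ = 1` for `t ∼ v`. [folklore] -/
theorem ss_norm_dartUnit : ∀ (v t : HexVertex), hexGraph.Adj v t → ‖dartUnit v t‖ = 1 := by
  intro v t hvt
  have h0 : hexCenter v - hexCenter t ≠ 0 := hexCenter_sub_ne_zero_of_adj hvt.symm
  unfold dartUnit
  rw [norm_div, Complex.norm_real, Real.norm_of_nonneg (norm_nonneg _),
    div_self (norm_ne_zero_iff.2 h0)]

/-- **The three darts at a `1`-deep vertex sum to zero**: `Σ_{t ∈ star Λ v} e(t) = 0`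
(the darts are `e, ζ²e, ζ⁴e` and `1 + ζ² + ζ⁴ = 0`). [folklore] -/
theorem ss_sum_dartUnit : ∀ (Λ : Finset HexVertex) (v : HexVertex), Deep Λ v 1 →
    ∑ t ∈ star Λ v, dartUnit v t = 0 := by
  intro Λ v hdeep
  obtain ⟨s, hs⟩ := srcDiff_exists_adj v
  obtain ⟨n1, n2, n3⟩ := tip_rot3_ne hs
  rw [tip_star_eq hs (srcDiff_nbrs_mem hdeep), Finset.sum_insert (by simp [n1, n2]),
    Finset.sum_pair n3, srcDiff_dartUnit_rot3, srcDiff_dartUnit_rot3_rot3]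
  linear_combination dartUnit v s * srcDiff_one_sub_exp_sub_exp

/-- **The squared darts at a `1`-deep vertex sum to zero**: `Σ_{t ∈ star Λ v} e(t)² = 0`
(`1 + ζ⁴ + ζ⁸ = 0`). [folklore] -/
theorem ss_sum_dartUnit_sq : ∀ (Λ : Finset HexVertex) (v : HexVertex), Deep Λ v 1 →
    ∑ t ∈ star Λ v, dartUnit v t ^ 2 = 0 := by
  intro Λ v hdeep
  obtain ⟨s, hs⟩ := srcDiff_exists_adj v
  obtain ⟨n1, n2, n3⟩ := tip_rot3_ne hs
  rw [tip_star_eq hs (srcDiff_nbrs_mem hdeep), Finset.sum_insert (by simp [n1, n2]),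
    Finset.sum_pair n3, srcDiff_dartUnit_rot3, srcDiff_dartUnit_rot3_rot3]
  linear_combination dartUnit v s ^ 2 * srcDiff_one_add_exp_sq_add_exp_sq

/-- **Registered helper `ss_sum_conj_dartUnit`**: `Σ_{t ∈ star Λ v} ē(t) = 0` at a `1`-deep `v` —
the weights of the `S`-source sum to zero. [folklore] -/
theorem ss_sum_conj_dartUnit : ∀ (Λ : Finset HexVertex) (v : HexVertex), Deep Λ v 1 →
    ∑ t ∈ star Λ v, (starRingEnd ℂ) (dartUnit v t) = 0 := by
  intro Λ v hdeep
  rw [← map_sum, ss_sum_dartUnit Λ v hdeep, map_zero]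

/-- **Registered helper `ss_sum_conj_dartUnit_sq`**: `Σ_{t ∈ star Λ v} ē(t)² = 0` at a `1`-deep
`v` — the weights of the `U`-source sum to zero. [folklore] -/
theorem ss_sum_conj_dartUnit_sq : ∀ (Λ : Finset HexVertex) (v : HexVertex), Deep Λ v 1 →
    ∑ t ∈ star Λ v, (starRingEnd ℂ) (dartUnit v t) ^ 2 = 0 := by
  intro Λ v hdeep
  simp_rw [← map_pow]
  rw [← map_sum, ss_sum_dartUnit_sq Λ v hdeep, map_zero]

/-! ### Pure differences -/

/-- **Weights of total mass zero see only differences**: if `Σ_{t ∈ T} a(t) = 0` then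
`Σ_t a(t) g(t) = Σ_t a(t) (g(t) - c)` for every constant `c`. [folklore] -/
theorem ss_sum_weight_mul_eq_diff : ∀ (T : Finset HexVertex) (a g : HexVertex → ℂ) (c : ℂ),
    ∑ t ∈ T, a t = 0 → ∑ t ∈ T, a t * g t = ∑ t ∈ T, a t * (g t - c) := by
  intro T a g c ha
  simp only [mul_sub, Finset.sum_sub_distrib, ← Finset.sum_mul, ha, zero_mul, sub_zero]

/-- **Registered helper `ss_signalSource_eq_diff` — the `S`-source is a pure difference**:
at a `1`-deep `v`, `signalSource(v) = Σ_{t ∈ star Λ v} ē(t) (S(t) - S(v))`, `S = A_{5/8}`.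
This exhibits the stub `stub_signalStarGradient` as a one-step modulus-of-continuity statement for
the signal sector; it proves nothing about the decay. [folklore] -/
theorem ss_signalSource_eq_diff : ∀ (Λ : Finset HexVertex) (u w v : HexVertex), Deep Λ v 1 →
    signalSource Λ u w v = ∑ t ∈ star Λ v, (starRingEnd ℂ) (dartUnit v t) *
      (arrivalSum Λ s(u, w) (rootAngle u w) (5 / 8) t -
        arrivalSum Λ s(u, w) (rootAngle u w) (5 / 8) v) := by
  intro Λ u w v hdeep
  exact ss_sum_weight_mul_eq_diff _ _ _ _ (ss_sum_conj_dartUnit Λ v hdeep)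

/-- **Registered helper `ss_unstableSource_eq_diff` — the `U`-source is a pure difference**:
at a `1`-deep `v`, `unstableSource(v) = Σ_{t ∈ star Λ v} ē(t)² (U(t) - U(v))`, `U = A_{-3/8}`.
This exhibits the stub `stub_unstableStarGradient` as a one-step modulus-of-continuity statement for
the unstable sector; it proves nothing about the decay. [folklore] -/
theorem ss_unstableSource_eq_diff : ∀ (Λ : Finset HexVertex) (u w v : HexVertex), Deep Λ v 1 →
    unstableSource Λ u w v = ∑ t ∈ star Λ v, (starRingEnd ℂ (dartUnit v t)) ^ 2 *
      (arrivalSum Λ s(u, w) (rootAngle u w) (-3 / 8) t -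
        arrivalSum Λ s(u, w) (rootAngle u w) (-3 / 8) v) := by
  intro Λ u w v hdeep
  exact ss_sum_weight_mul_eq_diff _ _ _ _ (ss_sum_conj_dartUnit_sq Λ v hdeep)

/-! ### One-step Lipschitz (modulus-of-continuity) majorants -/

/-- **Registered helper `ss_norm_signalSource_le`**: at a `1`-deep `v`,
`‖signalSource(v)‖ ≤ Σ_{t ∈ star Λ v} ‖S(t) - S(v)‖` (pure difference + unimodular darts).  A
triangle inequality; it proves nothing about the decay asked by `stub_signalStarGradient`. [folklore] -/
theorem ss_norm_signalSource_le : ∀ (Λ : Finset HexVertex) (u w v : HexVertex), Deep Λ v 1 →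
    ‖signalSource Λ u w v‖ ≤ ∑ t ∈ star Λ v,
      ‖arrivalSum Λ s(u, w) (rootAngle u w) (5 / 8) t -
        arrivalSum Λ s(u, w) (rootAngle u w) (5 / 8) v‖ := by
  intro Λ u w v hdeep
  rw [ss_signalSource_eq_diff Λ u w v hdeep]
  refine (norm_sum_le _ _).trans (Finset.sum_le_sum fun t ht => ?_)
  obtain ⟨-, hvt⟩ := tip_mem_star.1 ht
  rw [norm_mul, Complex.norm_conj, ss_norm_dartUnit v t hvt, one_mul]

/-- **Registered helper `ss_norm_unstableSource_le`**: at a `1`-deep `v`,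
`‖unstableSource(v)‖ ≤ Σ_{t ∈ star Λ v} ‖U(t) - U(v)‖`.  A triangle inequality; it proves nothing
about the decay asked by `stub_unstableStarGradient`. [folklore] -/
theorem ss_norm_unstableSource_le : ∀ (Λ : Finset HexVertex) (u w v : HexVertex), Deep Λ v 1 →
    ‖unstableSource Λ u w v‖ ≤ ∑ t ∈ star Λ v,
      ‖arrivalSum Λ s(u, w) (rootAngle u w) (-3 / 8) t -
        arrivalSum Λ s(u, w) (rootAngle u w) (-3 / 8) v‖ := by
  intro Λ u w v hdeep
  rw [ss_unstableSource_eq_diff Λ u w v hdeep]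
  refine (norm_sum_le _ _).trans (Finset.sum_le_sum fun t ht => ?_)
  obtain ⟨-, hvt⟩ := tip_mem_star.1 ht
  rw [norm_mul, norm_pow, Complex.norm_conj, ss_norm_dartUnit v t hvt, one_pow, one_mul]

/-- **Stub 5 follows from a Lipschitz decay of the signal sector** (registered helper
`ss_decayBound_signalSource_of_diff`): if the one-step modulus of continuity
`Σ_{t ∼ v} ‖S(t) - S(v)‖` decays against the star mass at rate `θ` with constant `C`, then so does
`signalSource` — `DecayBound signalSource C θ`.  The hypothesis is the open content of
`stub_signalStarGradient`; nothing about it is proved here. [folklore] -/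
theorem ss_decayBound_signalSource_of_diff : ∀ (C θ : ℝ),
    DecayBound (fun Λ u w v => ((∑ t ∈ star Λ v,
      ‖arrivalSum Λ s(u, w) (rootAngle u w) (5 / 8) t -
        arrivalSum Λ s(u, w) (rootAngle u w) (5 / 8) v‖ : ℝ) : ℂ)) C θ →
      DecayBound signalSource C θ := by
  intro C θ h Λ hΛ u w huw hu hw v R hR hdeep
  have hdeep1 : Deep Λ v 1 := fun y hy => hdeep y (hy.trans hR)
  have hb := h Λ hΛ u w huw hu hw v R hR hdeep
  rw [Complex.norm_of_nonneg (Finset.sum_nonneg fun _ _ => norm_nonneg _)] at hb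
  exact (ss_norm_signalSource_le Λ u w v hdeep1).trans hb

/-- **Stub 4 follows from a Lipschitz decay of the unstable sector** (registered helper
`ss_decayBound_unstableSource_of_diff`): if `Σ_{t ∼ v} ‖U(t) - U(v)‖` decays against the star mass
at rate `θ` with constant `C`, then `DecayBound unstableSource C θ`.  The hypothesis is the open
content of `stub_unstableStarGradient`; nothing about it is proved here. [folklore] -/
theorem ss_decayBound_unstableSource_of_diff : ∀ (C θ : ℝ),
    DecayBound (fun Λ u w v => ((∑ t ∈ star Λ v,
      ‖arrivalSum Λ s(u, w) (rootAngle u w) (-3 / 8) t -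
        arrivalSum Λ s(u, w) (rootAngle u w) (-3 / 8) v‖ : ℝ) : ℂ)) C θ →
      DecayBound unstableSource C θ := by
  intro C θ h Λ hΛ u w huw hu hw v R hR hdeep
  have hdeep1 : Deep Λ v 1 := fun y hy => hdeep y (hy.trans hR)
  have hb := h Λ hΛ u w huw hu hw v R hR hdeep
  rw [Complex.norm_of_nonneg (Finset.sum_nonneg fun _ _ => norm_nonneg _)] at hb
  exact (ss_norm_unstableSource_le Λ u w v hdeep1).trans hb

end Summit.CriticalPhenomena.SAWScalingLimit.Theorems.DefectDecoherence.SectorSlaving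

end
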